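import Summits.CriticalPhenomena.PercolationContinuityZ3.Theorems.Transplant.KNCellsBoxProdZ2Conc
import HarnessLib

/-!
# The concentric `X □ ℤ²` cell geometry with a GENERAL (position-dependent) fibre-radius schedule: every region type carries its own
# radius function of all its indices, the corridor profile depends on anchor, cell and direction; the six geometry records of
# `samePWitnessAt_of_kit₂'` from the eight order inequalities `ConcRadiiG.WF` that the record fields actually use

builds on p205010 (kernel theorem, internal audit signed; external expert review pending) — nothing in this file uses p205010.
Lane `prim-bschramm`, seat `prim-bschramm-p3` (orders I1/I2 of V56); helper file (`--supports stmt-CriticalPhenomena-4575 --as helper`).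

WHY (seat analysis, HOME/prim-bschramm-p3/STATUS.md 14:3xZ): in the lag-1 layer the root has `arr 0 = dep 0 = a₀` (KNCells2Scheme
`astOf₂ []`), so the root's children get `arr = a₀` as well: at the root anchor THREE planar generations share one anchor value (root seed
cube `Q_{a₀}(0)`, the children's cubes / stubs / far boxes, the grandchildren's cubes / targets), which the (D) contract orders strictly
(`seed + gap ≤ E₁ < F₂ < E₂ …`).  An anchor-only schedule (`KNCellsBoxProdZ2ConcF`) cannot express this; here the radii are arbitrary
functions and the schedule author (lead's `ConcSchedule`) proves `WF`.  From anchor `1` on, `dep = arr + 1` (depB uses the stub anchor) and an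
anchor-only schedule is recovered by ignoring the cell argument.
* `ConcRadiiG` (`rQ rM rC : ℕ → Site 2 → ℕ`, `rB rE : ℕ → Site 2 → MDir → ℕ`, `ρ : ℕ → Site 2 → MDir → ℤ → ℕ`), `ConcRadiiG.WF C`
  (8 inequality families, one per containment field); `cellGeomCG`, `faceDataCG` (zones carry the between-box radius);
* **`runGeomCG`, `anchGeomCG`, `sepGeomCG`, `sepGeom₂CG`, `exitGeomCG`, `stepsGeomCG`, `levelGeomCG`**.

[cite: KozmaNitzan2024, §4 pp. 25–27, 30–31 (Q_v, M_v, E_{v,x}, H^j_{v,x}, F^j_{v,x}) — the ℤ^d model]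
-/

noncomputable section

open scoped Classical

namespace Summit.CriticalPhenomena.PercolationContinuityZ3.Theorems

namespace Transplant

namespace BoxProdZ2

open Literature.Probability.Percolation Literature.Probability.LatticeModels SimpleGraph GadgetSystem Contour KNCells
open Literature.Probability.Percolation.KozmaNitzan.Cells (oth oth_ne oth_oth sgOf sgOf_sign stepVec_apply_fst stepVec_apply_oth eq_oth_of_ne)
open Literature.Barriers.CriticalPhenomena (graphBall graphBall_finite mem_graphBall_self graphBall_mono)

variable {W : Type} (X : SimpleGraph W) [X.LocallyFinite]

/-! ## §1 The general radius schedule -/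

/-- **A general fibre-radius schedule**: the fibre radius of every region as a function of all its indices (anchor, macro-vertex,
direction) and the corridor profile as a function of (anchor, macro-vertex, direction, planar level). [this work] -/
structure ConcRadiiG where
  /-- radius of the cube `Q a v` -/
  rQ : ℕ → Site 2 → ℕ
  /-- radius of the target cube `M a v` -/
  rM : ℕ → Site 2 → ℕ
  /-- radius of the cell `Cell a v` (bookkeeping) -/
  rC : ℕ → Site 2 → ℕ
  /-- radius of the between-box `Btw a v δ` (and of the zone `Zone a v δ`) -/
  rB : ℕ → Site 2 → MDir → ℕ
  /-- radius of the far box `Efar a v δ` -/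
  rE : ℕ → Site 2 → MDir → ℕ
  /-- corridor profile: radius of `Stub / Face / Hfull a v δ` at planar level `ℓ` -/
  ρ : ℕ → Site 2 → MDir → ℤ → ℕ

/-- **Well-formedness** w.r.t. the planar cells `C`: exactly the eight order families the record fields use (admissible departure anchors
are `a' ∈ {a, a+1}`). [this work] -/
structure ConcRadiiG.WF (C : PCells) (Λ : ConcRadiiG) : Prop where
  /-- `Q_a x ⊆ Cell_{a'} x` -/
  QC : ∀ a a' x, a' ∈ ({a, a + 1} : Finset ℕ) → Λ.rQ a x ≤ Λ.rC a' x
  /-- `Btw_{a'} v δ ⊆ Cell_a v ∪ …` -/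
  BC : ∀ a a' v δ, a' ∈ ({a, a + 1} : Finset ℕ) → Λ.rB a' v δ ≤ Λ.rC a v
  /-- `Btw_a v δ ⊆ … ∪ Cell_{a'} (v + δ)` -/
  BC' : ∀ a a' v δ, a' ∈ ({a, a + 1} : Finset ℕ) → Λ.rB a v δ ≤ Λ.rC a' (v + stepVec δ)
  /-- the base rows (levels `≤ 5r`) of the corridor sets at `a'` lie in the cube `Q_a v` -/
  ρQ : ∀ a a' v δ ℓ, a' ∈ ({a, a + 1} : Finset ℕ) → ℓ ≤ 5 * (C.r : ℤ) → Λ.ρ a' v δ ℓ ≤ Λ.rQ a v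
  /-- the corridor profile stays inside the far box -/
  ρE : ∀ a v δ ℓ, Λ.ρ a v δ ℓ ≤ Λ.rE a v δ
  /-- the far box inside the between-box -/
  EB : ∀ a v δ, Λ.rE a v δ ≤ Λ.rB a v δ
  /-- the far box inside the next cube -/
  EQ : ∀ a v δ, Λ.rE a v δ ≤ Λ.rQ a (v + stepVec δ)
  /-- the target cube of `v + δ` inside the far box of `(v, δ)` -/
  ME : ∀ a v δ, Λ.rM a (v + stepVec δ) ≤ Λ.rE a v δ

namespace ConcRadiiG.WF

variable {C : PCells} {Λ : ConcRadiiG} (hΛ : Λ.WF C)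
include hΛ

omit hΛ in
/-- `a ∈ {a, a+1}`. [folklore] -/
theorem mem_self (a : ℕ) : a ∈ ({a, a + 1} : Finset ℕ) := Finset.mem_insert_self a {a + 1}

/-- `ρ a v δ ℓ ≤ rB a v δ`. [folklore] -/
theorem ρB (a : ℕ) (v : Site 2) (δ : MDir) (ℓ : ℤ) : Λ.ρ a v δ ℓ ≤ Λ.rB a v δ := (hΛ.ρE a v δ ℓ).trans (hΛ.EB a v δ)

/-- `ρ a' v δ ℓ ≤ rC a v` for an admissible `a'`. [folklore] -/
theorem ρC {a a' : ℕ} (v : Site 2) (δ : MDir) (ℓ : ℤ) (h : a' ∈ ({a, a + 1} : Finset ℕ)) : Λ.ρ a' v δ ℓ ≤ Λ.rC a v :=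
  (hΛ.ρB a' v δ ℓ).trans (hΛ.BC a a' v δ h)

/-- `rM a w ≤ rQ a w` (through the far box of a neighbouring edge). [folklore] -/
theorem MQ (a : ℕ) (w : Site 2) : Λ.rM a w ≤ Λ.rQ a w := by
  have h1 := hΛ.ME a (w - stepVec (0, true)) (0, true)
  have h2 := hΛ.EQ a (w - stepVec (0, true)) (0, true)
  rw [sub_add_cancel] at h1 h2
  exact h1.trans h2

end ConcRadiiG.WF

/-! ## §2 The cell geometry -/

section Geom

variable [DecidableEq W]

/-- **The concentric `X □ ℤ²` cell geometry with a general schedule** over the anchor type `ℕ`: KN's planar cells times fibre balls about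
the root fibre `w₀`; staircase stubs with profile `ρ a v δ`; anchor rule `a ↦ a + 1`, admissible anchors `{a, a+1}`.
[cite: KozmaNitzan2024, §4 pp. 25–26 (Q_v, M_v, E_{v,x}, H^j_{v,x})] -/
def cellGeomCG (C : PCells) (w₀ : W) (Λ : ConcRadiiG) : CellGeom (W × Site 2) ℕ where
  K := C.K
  root := (w₀, 0)
  a₀ := 0
  Q := fun a v => ballFin X w₀ (Λ.rQ a v) ×ˢ C.Q v
  M := fun a v => ballFin X w₀ (Λ.rM a v) ×ˢ C.M v
  Cell := fun a v => ballFin X w₀ (Λ.rC a v) ×ˢ C.Cell v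
  Btw := fun a v δ => ballFin X w₀ (Λ.rB a v δ) ×ˢ C.Btw v δ
  Efar := fun a v δ => ballFin X w₀ (Λ.rE a v δ) ×ˢ C.Efar v δ
  Stub := fun a v δ j => stair X w₀ (fun t => Λ.ρ a v δ (C.lev δ v t)) (C.Stub v δ j)
  Zone := fun a v δ => ballFin X w₀ (Λ.rB a v δ) ×ˢ C.Zone v δ
  col := fun x => {y | y.2 = C.cen x}
  anchor := fun a _ _ => a + 1
  anchSet := fun a _ => {a, a + 1}
  anchor_mem := fun a _ _ => Finset.mem_insert_of_mem (Finset.mem_singleton_self _)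
  stub_mono := fun _ v δ _ _ h => stair_mono X (C.Stub_mono v δ h) fun _ _ => le_rfl
  hK := by have := C.hK; omega

/-- **Faces and corridors** with the same profile as the stubs. [cite: KozmaNitzan2024, §4 p. 26 (H_{v,x}), p. 30 (F^j_{v,x})] -/
def faceDataCG (C : PCells) (w₀ : W) (Λ : ConcRadiiG) : FaceData (W × Site 2) ℕ where
  Face := fun a v δ j => stair X w₀ (fun t => Λ.ρ a v δ (C.lev δ v t)) (C.Face v δ j)
  Hfull := fun a v δ => stair X w₀ (fun t => Λ.ρ a v δ (C.lev δ v t)) (C.Hfull v δ)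

variable (C : PCells) (w₀ : W) {Λ : ConcRadiiG} (hΛ : Λ.WF C)

/-! ## §3 The six records -/

/-- `RunGeom`: planar steps inside the boxes (transverse steps inside the staircase stubs). [folklore] -/
theorem runGeomCG : RunGeom (X □ zdGraph 2) (cellGeomCG X C w₀ Λ) where
  adjQ _ v _ hy := exists_adj_product X (fun _ ht => C.exists_adj_of_mem_Q v ht) hy
  adjBtw _ v δ _ hy := exists_adj_product X (fun _ ht => C.exists_adj_of_mem_Btw v δ ht) hy
  adjStub a v δ j _ y hy := by
    change y ∈ stair X w₀ (fun t => Λ.ρ a v δ (C.lev δ v t)) (C.Stub v δ j) at hy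
    rw [mem_stair] at hy
    obtain ⟨t', ht', hadj, hlev⟩ := exists_adj_sameLevel_of_mem_Stub C v δ j hy.1
    refine ⟨(y.1, t'), ?_, (boxProd_adj).2 (Or.inr ⟨hadj, rfl⟩)⟩
    change (y.1, t') ∈ stair X w₀ (fun t => Λ.ρ a v δ (C.lev δ v t)) (C.Stub v δ j)
    rw [mem_stair]
    refine ⟨ht', ?_⟩
    change y.1 ∈ ballFin X w₀ (Λ.ρ a v δ (C.lev δ v t'))
    rw [hlev]; exact hy.2

/-- `AnchGeom`: `a ∈ {a, a+1}`, and the admissible anchors do not depend on the macro-vertex. [folklore] -/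
theorem anchGeomCG : AnchGeom (cellGeomCG X C w₀ Λ) where
  refl a _ := Finset.mem_insert_self a {a + 1}
  const _ _ _ := rfl

include hΛ

/-- **`SepGeom`** for the general schedule (containments from `WF`, disjointness / separation planar). [cite: KozmaNitzan2024, §4 pp. 26–29] -/
theorem sepGeomCG : SepGeom (X □ zdGraph 2) (cellGeomCG X C w₀ Λ) where
  anch_refl a _ := Finset.mem_insert_self a {a + 1}
  root_mem := by
    change (w₀, (0 : Site 2)) ∈ ballFin X w₀ (Λ.rQ 0 0) ×ˢ C.Q 0
    exact Finset.mem_product.2 ⟨(mem_ballFin X).2 (mem_graphBall_self X w₀ _), C.zero_mem_Q_zero⟩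
  Q_subset_Cell a v :=
    Finset.product_subset_product (ballFin_mono X w₀ (hΛ.QC a a v (ConcRadiiG.WF.mem_self a))) (C.Q_subset_Cell v)
  Btw_subset_Cells a a' v δ ha' := by
    change ballFin X w₀ (Λ.rB a' v δ) ×ˢ C.Btw v δ ⊆
      ballFin X w₀ (Λ.rC a v) ×ˢ C.Cell v ∪ ballFin X w₀ (Λ.rC a' (v + stepVec δ)) ×ˢ C.Cell (v + stepVec δ)
    exact product_subset_union (ballFin_mono X w₀ (hΛ.BC a a' v δ ha'))
      (ballFin_mono X w₀ (hΛ.BC' a' a' v δ (ConcRadiiG.WF.mem_self a'))) (C.Btw_subset_Cells v δ)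
  Stub_subset_Q_union_Btw a a' v δ j ha' hj := by
    change stair X w₀ (fun t => Λ.ρ a' v δ (C.lev δ v t)) (C.Stub v δ j) ⊆
      ballFin X w₀ (Λ.rQ a v) ×ˢ C.Q v ∪ ballFin X w₀ (Λ.rB a' v δ) ×ˢ C.Btw v δ
    refine stair_subset_union X (C.Stub_subset_Q_union_Btw v δ (by change j + 1 ≤ C.K at hj; omega)) ?_ ?_
    · intro t _ htQ
      exact hΛ.ρQ a a' v δ _ ha' (C.lev_le_of_mem_Q htQ)
    · intro t _ _; exact hΛ.ρB a' v δ _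
  Stub_subset_Cell_union_Zone a a' v δ j ha' hj := by
    change stair X w₀ (fun t => Λ.ρ a' v δ (C.lev δ v t)) (C.Stub v δ j) ⊆
      ballFin X w₀ (Λ.rC a v) ×ˢ C.Cell v ∪ ballFin X w₀ (Λ.rB a' v δ) ×ˢ C.Zone v δ
    refine stair_subset_union X (C.Stub_subset_Cell_union_Zone v δ (by change j + 1 ≤ C.K at hj; omega)) ?_ ?_
    · intro t _ _; exact hΛ.ρC v δ _ ha'
    · intro t _ _; exact hΛ.ρB a' v δ _
  Efar_subset_Btw_union_Q a v δ := by
    change ballFin X w₀ (Λ.rE a v δ) ×ˢ C.Efar v δ ⊆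
      ballFin X w₀ (Λ.rB a v δ) ×ˢ C.Btw v δ ∪ ballFin X w₀ (Λ.rQ a (v + stepVec δ)) ×ˢ C.Q (v + stepVec δ)
    exact product_subset_union (ballFin_mono X w₀ (hΛ.EB a v δ)) (ballFin_mono X w₀ (hΛ.EQ a v δ)) (C.Efar_subset_Btw_union_Q v δ)
  Ewv_disjoint_Efar a a' w δw du hdu := by
    change Disjoint (ballFin X w₀ (Λ.rB a w δw) ×ˢ C.Btw w δw ∪ ballFin X w₀ (Λ.rQ a (w + stepVec δw)) ×ˢ C.Q (w + stepVec δw))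
      (ballFin X w₀ (Λ.rE a' (w + stepVec δw) du) ×ˢ C.Efar (w + stepVec δw) du)
    have h := C.Ewv_disjoint_Efar w hdu
    rw [PCells.Ewv, Finset.disjoint_union_left] at h
    rw [Finset.disjoint_union_left]
    exact ⟨disjoint_product_of_right h.1, disjoint_product_of_right h.2⟩
  Q_disjoint_Q a a' u x hux := disjoint_product_of_right (C.Q_disjoint_Q hux)
  Q_disjoint_Btw a a' x v δ := disjoint_product_of_right (C.Q_disjoint_Btw x v δ)
  Btw_disjoint_Btw a a' v δ v' δ' h1 h2 := disjoint_product_of_right (C.Btw_disjoint_Btw h1 h2)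
  Q_disjoint_Efar a a' v δ := disjoint_product_of_right (C.Q_disjoint_Efar v δ)
  Btw_disjoint_Efar a a' v δ δ' h := disjoint_product_of_right (C.Btw_disjoint_Efar v h)
  col_Q a x := ⟨(w₀, C.cen x), Finset.mem_product.2 ⟨(mem_ballFin X).2 (mem_graphBall_self X w₀ _), C.cen_mem_Q x⟩, rfl⟩
  col_Cell a u x hux y hy hcol := by
    change y.2 = C.cen x at hcol
    exact C.cen_not_mem_Cell hux (hcol ▸ (Finset.mem_product.1 hy).2)
  col_Zone a u δ x y hy hcol := by
    change y.2 = C.cen x at hcol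
    exact C.cen_not_mem_Zone u δ x (hcol ▸ (Finset.mem_product.1 hy).2)

/-- **`SepGeom₂`** (cross-anchor containments `Q_a ⊆ Cell_{a'}`, `Btw_a ⊆ Cell_a ∪ Cell_{a'}` for `a' ∈ {a, a+1}`). [cite: KozmaNitzan2024, §4 pp. 25–26] -/
theorem sepGeom₂CG : SepGeom₂ (X □ zdGraph 2) (cellGeomCG X C w₀ Λ) where
  toSepGeom := sepGeomCG X C w₀ hΛ
  Q_subset_Cell₂ a a' x ha' := by
    change ballFin X w₀ (Λ.rQ a x) ×ˢ C.Q x ⊆ ballFin X w₀ (Λ.rC a' x) ×ˢ C.Cell x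
    exact Finset.product_subset_product (ballFin_mono X w₀ (hΛ.QC a a' x ha')) (C.Q_subset_Cell x)
  Btw_subset_Cells₂ a a' v δ ha' := by
    change ballFin X w₀ (Λ.rB a v δ) ×ˢ C.Btw v δ ⊆
      ballFin X w₀ (Λ.rC a v) ×ˢ C.Cell v ∪ ballFin X w₀ (Λ.rC a' (v + stepVec δ)) ×ˢ C.Cell (v + stepVec δ)
    exact product_subset_union (ballFin_mono X w₀ (hΛ.BC a a v δ (ConcRadiiG.WF.mem_self a)))
      (ballFin_mono X w₀ (hΛ.BC' a a' v δ ha')) (C.Btw_subset_Cells v δ)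

/-- **`ExitGeom`** for the general schedule. [cite: KozmaNitzan2024, §4 pp. 26–27] -/
theorem exitGeomCG : ExitGeom (X □ zdGraph 2) (cellGeomCG X C w₀ Λ) where
  M_subset_Q a v := Finset.product_subset_product (ballFin_mono X w₀ (hΛ.MQ a v)) (C.M_subset_Q v)
  Cell_disjoint_Q a a' u x hux := disjoint_product_of_right (C.Cell_disjoint_Q hux)
  Zone_disjoint_Q a a' u δ x := disjoint_product_of_right (C.Zone_disjoint_Q u δ x)
  locFin y := by
    set B : Site 2 := fun i => |y.2 i| + 35 * C.r + 1 with hB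
    refine (Finset.Icc (-B) B).finite_toSet.subset ?_
    rintro v ⟨a, w, δ, rfl, b, hb, hadj⟩
    change b ∈ ballFin X w₀ (Λ.rB a w δ) ×ˢ C.Btw w δ ∪ ballFin X w₀ (Λ.rQ a (w + stepVec δ)) ×ˢ C.Q (w + stepVec δ) at hb
    have hb2 : b.2 ∈ C.Ewv w δ := by
      rw [PCells.Ewv, Finset.mem_union]
      rcases Finset.mem_union.1 hb with h | h
      · exact Or.inl (Finset.mem_product.1 h).2
      · exact Or.inr (Finset.mem_product.1 h).2
    have hnear : ∀ i, |b.2 i - y.2 i| ≤ 1 := by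
      intro i
      rcases (boxProd_adj).1 hadj with ⟨-, h2⟩ | ⟨h2, -⟩
      · rw [h2, sub_self, abs_zero]; exact zero_le_one
      · exact abs_sub_comm (b.2 i) (y.2 i) ▸ DCT16.abs_sub_le_one_of_adj h2 i
    rw [Finset.coe_Icc, Set.mem_Icc]
    have key : ∀ i, |(w + stepVec δ) i| ≤ B i := by
      intro i
      have h1 := sub_cen_le_of_mem_Ewv C hb2 i
      have h2 := hnear i
      rw [abs_le] at h1 h2 ⊢
      simp only [PCells.cen_apply] at h1
      simp only [hB]
      have hy := abs_nonneg (y.2 i)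
      have hy' := le_abs_self (y.2 i)
      have hy'' := neg_abs_le (y.2 i)
      have hr : (1 : ℤ) ≤ C.r := by exact_mod_cast C.one_le_r
      constructor <;> nlinarith
    exact ⟨fun i => (abs_le.1 (key i)).1, fun i => (abs_le.1 (key i)).2⟩

/-- **`StepsGeom`** for the general schedule (faces ⊆ stubs ⊆ corridor: same profile; corridor ⊆ `Q_a ∪ E^far_{a'}`: base levels by
`WF.ρQ`, the rest by `WF.ρE`). [cite: KozmaNitzan2024, §4 pp. 26, 30] -/
theorem stepsGeomCG : StepsGeom (cellGeomCG X C w₀ Λ) (faceDataCG X C w₀ Λ) where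
  Face_subset_Stub a v δ j := stair_mono X (C.Face_subset_Stub v δ j) fun _ _ => le_rfl
  Stub_subset_Hfull a v δ j hj := stair_mono X (C.Stub_subset_Hfull v δ (by change j ≤ C.K at hj; exact hj)) fun _ _ => le_rfl
  Hfull_subset a a' v δ ha' := by
    change stair X w₀ (fun t => Λ.ρ a' v δ (C.lev δ v t)) (C.Hfull v δ) ⊆
      ballFin X w₀ (Λ.rQ a v) ×ˢ C.Q v ∪ ballFin X w₀ (Λ.rE a' v δ) ×ˢ C.Efar v δ
    refine stair_subset_union X (C.Hfull_subset_Q_union_Efar v δ) ?_ ?_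
    · intro t _ htQ
      exact hΛ.ρQ a a' v δ _ ha' (C.lev_le_of_mem_Q htQ)
    · intro t _ _; exact hΛ.ρE a' v δ _
  M_tgt_subset_Efar a v δ := Finset.product_subset_product (ballFin_mono X w₀ (hΛ.ME a v δ)) (C.M_add_stepVec_subset_Efar v δ)

/-- **`LevelGeom`** for the general schedule (the staircase truncated at `L j` is the stub `H^j`; everything else planar). [cite: KozmaNitzan2024, §4 p. 31 (Step IV)] -/
theorem levelGeomCG : LevelGeom (X □ zdGraph 2) (cellGeomCG X C w₀ Λ) (faceDataCG X C w₀ Λ) (levelDataC (W := W) C) where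
  adj_le a' v δ y z h := by
    change C.lev δ v z.2 ≤ C.lev δ v y.2 + 1
    rcases (boxProd_adj).1 h with ⟨-, h2⟩ | ⟨h2, -⟩
    · rw [h2]; omega
    · rcases C.lev_adj δ v h2 with h' | h' | h' <;> omega
  lev_Q a a' v δ _ y hy := C.lev_le_of_mem_Q (Finset.mem_product.1 hy).2
  lev_Hfull a' v δ y hy hn := by
    change y ∈ stair X w₀ (fun t => Λ.ρ a' v δ (C.lev δ v t)) (C.Hfull v δ) at hy
    rw [mem_stair] at hy
    refine lev_le_of_mem_Hfull_not_Efar' C hy.1 fun h' => hn ?_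
    change y ∈ ballFin X w₀ (Λ.rE a' v δ) ×ˢ C.Efar v δ
    exact Finset.mem_product.2 ⟨ballFin_mono X w₀ (hΛ.ρE a' v δ _) hy.2, h'⟩
  ℓQ_lt j hj := by
    change 5 * (C.r : ℤ) < 5 * C.r + 10 * C.s * j
    have hs1 : (1 : ℤ) ≤ C.s := by exact_mod_cast C.hs
    have : (1 : ℤ) ≤ j := by exact_mod_cast hj
    nlinarith
  mem_Stub a' v δ j _ _ y hy hl := by
    change y ∈ stair X w₀ (fun t => Λ.ρ a' v δ (C.lev δ v t)) (C.Hfull v δ) at hy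
    change y ∈ stair X w₀ (fun t => Λ.ρ a' v δ (C.lev δ v t)) (C.Stub v δ j)
    rw [mem_stair] at hy ⊢
    exact ⟨C.mem_Stub_of_mem_Hfull hy.1 hl, hy.2⟩
  mem_Face a' v δ j _ _ y hy hl := by
    change y ∈ stair X w₀ (fun t => Λ.ρ a' v δ (C.lev δ v t)) (C.Hfull v δ) at hy
    change y ∈ stair X w₀ (fun t => Λ.ρ a' v δ (C.lev δ v t)) (C.Face v δ j)
    rw [mem_stair] at hy ⊢
    exact ⟨C.mem_Face_of_mem_Hfull hy.1 hl, hy.2⟩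
  Face_far a' v δ j hjK t ht := by
    change t ∈ stair X w₀ (fun t => Λ.ρ a' v δ (C.lev δ v t)) (C.Face v δ (j + 1)) at ht
    rw [mem_stair] at ht
    obtain ⟨hE, hl⟩ := Face_far' C (by change j + 1 ≤ C.K at hjK; exact hjK) ht.1
    refine ⟨?_, hl⟩
    change t ∈ ballFin X w₀ (Λ.rE a' v δ) ×ˢ C.Efar v δ
    exact Finset.mem_product.2 ⟨ballFin_mono X w₀ (hΛ.ρE a' v δ _) ht.2, hE⟩
  M_far a' v δ t ht := by
    obtain ⟨h1, h2⟩ := Finset.mem_product.1 ht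
    have hl := C.lev_ge_of_mem_M_add (δ := δ) h2
    have hr : (1 : ℤ) ≤ C.r := by exact_mod_cast C.one_le_r
    have hrK : (C.r : ℤ) = C.K * C.s := by simp [PCells.r]
    refine ⟨Finset.mem_product.2 ⟨ballFin_mono X w₀ (hΛ.ME a' v δ) h1, C.M_add_stepVec_subset_Efar v δ h2⟩, ?_⟩
    change 5 * (C.r : ℤ) + 10 * C.s * (C.K : ℕ) + 1 ≤ C.lev δ v t.2
    nlinarith
  Btw_sep_Efar a a' w δw du hdu := by
    change KNCells.Sep (X □ zdGraph 2) (ballFin X w₀ (Λ.rB a w δw) ×ˢ C.Btw w δw) (ballFin X w₀ (Λ.rE a' (w + stepVec δw) du) ×ˢ C.Efar (w + stepVec δw) du)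
    rw [← C.Btw_rev' w δw]
    exact sep_prodR X (C.Btw_sep_Efar (w + stepVec δw) (Ne.symm hdu))
  Cell_sep_Efar b a' u v δ huv hux := sep_prodR X (C.Cell_sep_Efar huv hux)
  Zone_sep_Efar b a' u δ' v δ huv hux := sep_prodR X (C.Zone_sep_Efar huv hux δ')

end Geom

end BoxProdZ2

end Transplant

end Summit.CriticalPhenomena.PercolationContinuityZ3.Theorems

end
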